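import Summits.Ventures.PercRepro.GenQHypAddTwoC

/-!
# PercRepro — C-025 at `(q + 2, q)`: «hyperplane + two points» at EVERY type, part D — the profile functional and
the theorem (night-4, gen 2; part C = `GenQHypAddTwoC.lean`)

For `G = τ ∪ {a, a′}` (`ρ(τ) = q ≥ 1`, `a, a′ ∉ cl(τ)`, `ρ(G) = q + 1`) part C splits `R_{q+1}(G)` into the four
families `B″ ∪ {a}`, `B″ ∪ {a′}`, `B″ ∪ {a, a′}` over `B″ ∈ R_q(τ)` and `B″ ∪ {a, a′}` over `B″ ∈ RqPred` (the
rank-`(q − 1)` subsets of `τ` that `a, a′` lift to rank `q + 1`).  Their coloop counts are `m(B″) + 1`, `m(B″) + 1`,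
`≤ m(B″)`, `≤ m(B″) + 2` (`mTr_insert_le`, `mTr_insert_insert_le`) and their demands at type `t` are
`[ρ(τ ∖ B″) + 2 > t]`, `[ρ(τ ∖ B″) + 2 > t]`, `[ρ(τ ∖ B″) + 1 > t]`, `[ρ(τ ∖ B″) + 1 > t]` (the complement shapes of
part C).  Summing (`hfun_insert_left_ge`, `_right_ge`, `hfun_insert_insert_ge`, `_pred_ge`):

**`Jq_hyp_add_two_ge_profile`**: `hypAddTwoProfile M τ a a′ q t ≤ Jq M G (q + 1) t` for every type `t ≤ q + 1`,
where the profile functional is the explicit sum of the four contributions over `R_q(τ)` and `RqPred` — a statement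
about the hyperplane trace `τ` (and which of its rank-`(q − 1)` subsets the two points lift).  At `(q, t) = (3, 4)` this
is the reduction of p1's `PlaneAddTwoFour` (Theorem 21.6 at `t = 4`) to the rank-`3` profile inequality of mine-2's
§21.18.3, now at every level and every type: the residue of the «hyperplane + two points» corner of `𝔉_{q+1}` is
`0 ≤ hypAddTwoProfile` (`Jq_hyp_add_two_nonneg_of_profile`), a per-trace, size-dependent inequality.  At the top
type `t = q + 1` the fourth family and the `B″ ∪ {a, a′}` demands vanish and one recovers
`two_mul_Jq_le_Jq_hyp_add_two`.
Imports part C only.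
-/

namespace PercRepro.GenQ

open Finset ThmH SixFour

variable {α : Type*} [DecidableEq α] {M : Matroid α} [M.Finite]

section HypAddTwoAll

variable {τ : Finset α} {a a' : α} {q t : ℕ}

/-! ### The profile functional and the per-family bounds -/

/-- **The profile functional** of the hyperplane trace `τ` (with the two points `a, a′`) at level `q + 1` and
type `t`: the four families' contributions, written on `τ`. -/
noncomputable def hypAddTwoProfile (M : Matroid α) [M.Finite] (τ : Finset α) (a a' : α) (q t : ℕ) : ℚ :=
  (∑ B ∈ Rq M τ q,
      ((((q + 1 : ℕ) : ℚ) + 2 - t) * (2 * (1 / (2 + (mTr M B : ℚ))) + 1 / (1 + (mTr M B : ℚ))) -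
        ((((q + 1 : ℕ) : ℚ) + 2) / (((q + 1 : ℕ) : ℚ) + 1)) *
          (2 * (if M.eRk ((τ \ B : Finset α) : Set α) + 1 + 1 ≤ (t : ℕ∞) then (0 : ℚ) else 1) +
            dem M τ t B))) +
    ∑ B ∈ RqPred M τ a a' q,
      ((((q + 1 : ℕ) : ℚ) + 2 - t) * (1 / (3 + (mTr M B : ℚ))) -
        ((((q + 1 : ℕ) : ℚ) + 2) / (((q + 1 : ℕ) : ℚ) + 1)) * dem M τ t B)

/-- The summand of the balance at level `q + 1`, type `t`, on `G`. -/
noncomputable def hfun (M : Matroid α) [M.Finite] (G : Finset α) (q t : ℕ) (B : Finset α) : ℚ :=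
  (((q + 1 : ℕ) : ℚ) + 2 - t) * wInf M B -
    ((((q + 1 : ℕ) : ℚ) + 2) / (((q + 1 : ℕ) : ℚ) + 1)) * dem M G t B

/-- `Jq M G (q + 1) t = Σ_{B ∈ R_{q+1}(G)} hfun B`. -/
theorem Jq_succ_eq_sum_hfun (G : Finset α) (q t : ℕ) :
    Jq M G (q + 1) t = ∑ B ∈ Rq M G (q + 1), hfun M G q t B := by
  rw [Jq_eq_sum_dem]
  rfl

/-- The coefficient `(q + 3 − t)` is nonnegative for `t ≤ q + 1`. -/
theorem coeff_nonneg (hq : t ≤ q + 1) : (0 : ℚ) ≤ ((q + 1 : ℕ) : ℚ) + 2 - t := by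
  have : (t : ℚ) ≤ ((q + 1 : ℕ) : ℚ) := by exact_mod_cast hq
  linarith

/-- Family 1: `hfun (B ∪ {a})` against the profile term. -/
theorem hfun_insert_left_ge (ha' : a' ∈ gr M) (hne : a ≠ a') (haτ : a ∉ τ) (ha'τ : a' ∉ τ)
    (ha'cl : a' ∉ M.closure (τ : Set α)) (ht : t ≤ q + 1) {B : Finset α} (hB : B ∈ Rq M τ q) :
    (((q + 1 : ℕ) : ℚ) + 2 - t) * (1 / (2 + (mTr M B : ℚ))) -
        ((((q + 1 : ℕ) : ℚ) + 2) / (((q + 1 : ℕ) : ℚ) + 1)) *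
          (if M.eRk ((τ \ B : Finset α) : Set α) + 1 + 1 ≤ (t : ℕ∞) then (0 : ℚ) else 1) ≤
      hfun M (insert a (insert a' τ)) q t (insert a B) := by
  have hBτ := (mem_Rq.1 hB).1
  unfold hfun dem
  rw [sdiff_insert_left hne haτ ha'τ hBτ, eRk_insert_sub ha' ha'cl Finset.sdiff_subset]
  apply sub_le_sub_right
  apply mul_le_mul_of_nonneg_left _ (coeff_nonneg ht)
  unfold wInf
  apply one_div_le_one_div_of_le (by positivity)
  have := mTr_insert_le (M := M) B a
  have h' : (mTr M (insert a B) : ℚ) ≤ mTr M B + 1 := by exact_mod_cast this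
  linarith

/-- Family 2: `hfun (B ∪ {a′})` against the profile term. -/
theorem hfun_insert_right_ge (ha : a ∈ gr M) (hne : a ≠ a') (haτ : a ∉ τ) (ha'τ : a' ∉ τ)
    (hacl : a ∉ M.closure (τ : Set α)) (ht : t ≤ q + 1) {B : Finset α} (hB : B ∈ Rq M τ q) :
    (((q + 1 : ℕ) : ℚ) + 2 - t) * (1 / (2 + (mTr M B : ℚ))) -
        ((((q + 1 : ℕ) : ℚ) + 2) / (((q + 1 : ℕ) : ℚ) + 1)) *
          (if M.eRk ((τ \ B : Finset α) : Set α) + 1 + 1 ≤ (t : ℕ∞) then (0 : ℚ) else 1) ≤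
      hfun M (insert a (insert a' τ)) q t (insert a' B) := by
  have hBτ := (mem_Rq.1 hB).1
  unfold hfun dem
  rw [sdiff_insert_right hne haτ ha'τ hBτ, eRk_insert_sub ha hacl Finset.sdiff_subset]
  apply sub_le_sub_right
  apply mul_le_mul_of_nonneg_left _ (coeff_nonneg ht)
  unfold wInf
  apply one_div_le_one_div_of_le (by positivity)
  have := mTr_insert_le (M := M) B a'
  have h' : (mTr M (insert a' B) : ℚ) ≤ mTr M B + 1 := by exact_mod_cast this
  linarith

/-- Family 3: `hfun (B ∪ {a, a′})` for `B ∈ R_q(τ)` against the profile term. -/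
theorem hfun_insert_insert_ge (ha : a ∈ gr M) (ha' : a' ∈ gr M) (hne : a ≠ a') (haτ : a ∉ τ) (ha'τ : a' ∉ τ)
    (hacl : a ∉ M.closure (τ : Set α)) (ha'cl : a' ∉ M.closure (τ : Set α))
    (hrG : M.eRk ((insert a (insert a' τ) : Finset α) : Set α) = (q : ℕ∞) + 1) (ht : t ≤ q + 1)
    {B : Finset α} (hB : B ∈ Rq M τ q) :
    (((q + 1 : ℕ) : ℚ) + 2 - t) * (1 / (1 + (mTr M B : ℚ))) -
        ((((q + 1 : ℕ) : ℚ) + 2) / (((q + 1 : ℕ) : ℚ) + 1)) * dem M τ t B ≤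
      hfun M (insert a (insert a' τ)) q t (insert a (insert a' B)) := by
  have hBτ := (mem_Rq.1 hB).1
  have hBr := (mem_Rq.1 hB).2
  unfold hfun dem
  rw [sdiff_insert_insert haτ ha'τ B]
  apply sub_le_sub_right
  apply mul_le_mul_of_nonneg_left _ (coeff_nonneg ht)
  unfold wInf
  apply one_div_le_one_div_of_le (by positivity)
  have hr₃ : M.eRk ((insert a (insert a' B) : Finset α) : Set α) = (q : ℕ∞) + 1 := by
    have := (mem_Rq.1 (insert_insert_mem_Rq ha' ha'cl hrG hB)).2
    rw [this, Nat.cast_add_one]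
  have hm := mTr_insert_insert_le (M := M) ha ha' hne (fun h => haτ (hBτ h)) (fun h => ha'τ (hBτ h))
    (by rw [hr₃, eRk_insert_sub ha' ha'cl hBτ, hBr])
    (by rw [hr₃, eRk_insert_sub ha hacl hBτ, hBr])
  have h' : (mTr M (insert a (insert a' B)) : ℚ) ≤ mTr M B := by exact_mod_cast hm
  linarith

/-- Family 4: `hfun (B ∪ {a, a′})` for `B ∈ RqPred` against the profile term. -/
theorem hfun_insert_insert_pred_ge (haτ : a ∉ τ) (ha'τ : a' ∉ τ) (ht : t ≤ q + 1) {B : Finset α}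
    (_hB : B ∈ RqPred M τ a a' q) :
    (((q + 1 : ℕ) : ℚ) + 2 - t) * (1 / (3 + (mTr M B : ℚ))) -
        ((((q + 1 : ℕ) : ℚ) + 2) / (((q + 1 : ℕ) : ℚ) + 1)) * dem M τ t B ≤
      hfun M (insert a (insert a' τ)) q t (insert a (insert a' B)) := by
  unfold hfun dem
  rw [sdiff_insert_insert haτ ha'τ B]
  apply sub_le_sub_right
  apply mul_le_mul_of_nonneg_left _ (coeff_nonneg ht)
  unfold wInf
  apply one_div_le_one_div_of_le (by positivity)
  have h1 := mTr_insert_le (M := M) (insert a' B) a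
  have h2 := mTr_insert_le (M := M) B a'
  have h1' : (mTr M (insert a (insert a' B)) : ℚ) ≤ mTr M (insert a' B) + 1 := by exact_mod_cast h1
  have h2' : (mTr M (insert a' B) : ℚ) ≤ mTr M B + 1 := by exact_mod_cast h2
  linarith

/-! ### The main theorem -/

/-- **«Hyperplane + two points» at every type, by the same counting**: for `G = τ ∪ {a, a′}` with `ρ(τ) = q ≥ 1`,
`a, a′ ∉ cl(τ)`, `ρ(G) = q + 1`, and every type `t ≤ q + 1`, the balance of `G` at level `q + 1` dominates the
profile functional of `τ`. -/
theorem Jq_hyp_add_two_ge_profile (ha : a ∈ gr M) (ha' : a' ∈ gr M) (hne : a ≠ a') (haτ : a ∉ τ) (ha'τ : a' ∉ τ)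
    (hacl : a ∉ M.closure (τ : Set α)) (ha'cl : a' ∉ M.closure (τ : Set α))
    (hrτ : M.eRk (τ : Set α) = (q : ℕ∞)) (hrG : M.eRk ((insert a (insert a' τ) : Finset α) : Set α) = (q : ℕ∞) + 1)
    (hq : 1 ≤ q) (ht : t ≤ q + 1) :
    hypAddTwoProfile M τ a a' q t ≤ Jq M (insert a (insert a' τ)) (q + 1) t := by
  rw [Jq_succ_eq_sum_hfun, Rq_succ_eq_union ha ha' hne hacl ha'cl hrτ hrG hq]
  rw [Finset.sum_union (Finset.disjoint_union_left.2
      ⟨disjoint_im₁₂_im hne haτ ha'τ _, disjoint_im₃_im₄ hne haτ ha'τ hq⟩),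
    Finset.sum_union (disjoint_im₁₂_im hne haτ ha'τ _), Finset.sum_union (disjoint_im₁_im₂ hne haτ)]
  rw [Finset.sum_image (fun B hB B' hB' h => insert_inj_of_subset haτ (mem_Rq.1 hB).1 (mem_Rq.1 hB').1 h),
    Finset.sum_image (fun B hB B' hB' h => insert_inj_of_subset ha'τ (mem_Rq.1 hB).1 (mem_Rq.1 hB').1 h),
    Finset.sum_image (fun B hB B' hB' h =>
      insert_insert_inj_of_subset hne haτ ha'τ (mem_Rq.1 hB).1 (mem_Rq.1 hB').1 h),
    Finset.sum_image (fun B hB B' hB' h =>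
      insert_insert_inj_of_subset hne haτ ha'τ (subset_of_mem_RqPred hB) (subset_of_mem_RqPred hB') h)]
  unfold hypAddTwoProfile
  have h1 := Finset.sum_le_sum (fun B hB => hfun_insert_left_ge (M := M) ha' hne haτ ha'τ ha'cl ht hB)
  have h2 := Finset.sum_le_sum (fun B hB => hfun_insert_right_ge (M := M) ha hne haτ ha'τ hacl ht hB)
  have h3 := Finset.sum_le_sum (fun B hB => hfun_insert_insert_ge (M := M) ha ha' hne haτ ha'τ hacl ha'cl hrG ht hB)
  have h4 := Finset.sum_le_sum (fun B hB => hfun_insert_insert_pred_ge (M := M) haτ ha'τ ht hB)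
  have e : ∑ B ∈ Rq M τ q,
      ((((q + 1 : ℕ) : ℚ) + 2 - t) * (2 * (1 / (2 + (mTr M B : ℚ))) + 1 / (1 + (mTr M B : ℚ))) -
        ((((q + 1 : ℕ) : ℚ) + 2) / (((q + 1 : ℕ) : ℚ) + 1)) *
          (2 * (if M.eRk ((τ \ B : Finset α) : Set α) + 1 + 1 ≤ (t : ℕ∞) then (0 : ℚ) else 1) + dem M τ t B)) =
      ∑ B ∈ Rq M τ q, ((((q + 1 : ℕ) : ℚ) + 2 - t) * (1 / (2 + (mTr M B : ℚ))) -
        ((((q + 1 : ℕ) : ℚ) + 2) / (((q + 1 : ℕ) : ℚ) + 1)) *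
          (if M.eRk ((τ \ B : Finset α) : Set α) + 1 + 1 ≤ (t : ℕ∞) then (0 : ℚ) else 1)) +
      ∑ B ∈ Rq M τ q, ((((q + 1 : ℕ) : ℚ) + 2 - t) * (1 / (2 + (mTr M B : ℚ))) -
        ((((q + 1 : ℕ) : ℚ) + 2) / (((q + 1 : ℕ) : ℚ) + 1)) *
          (if M.eRk ((τ \ B : Finset α) : Set α) + 1 + 1 ≤ (t : ℕ∞) then (0 : ℚ) else 1)) +
      ∑ B ∈ Rq M τ q, ((((q + 1 : ℕ) : ℚ) + 2 - t) * (1 / (1 + (mTr M B : ℚ))) -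
        ((((q + 1 : ℕ) : ℚ) + 2) / (((q + 1 : ℕ) : ℚ) + 1)) * dem M τ t B) := by
    rw [← Finset.sum_add_distrib, ← Finset.sum_add_distrib]
    apply Finset.sum_congr rfl
    intro B _
    ring
  rw [e]
  linarith

/-- **The «hyperplane + two points» corner of `𝔉_{q+1}` at type `t` from the profile inequality of its trace.** -/
theorem Jq_hyp_add_two_nonneg_of_profile (ha : a ∈ gr M) (ha' : a' ∈ gr M) (hne : a ≠ a') (haτ : a ∉ τ)
    (ha'τ : a' ∉ τ) (hacl : a ∉ M.closure (τ : Set α)) (ha'cl : a' ∉ M.closure (τ : Set α))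
    (hrτ : M.eRk (τ : Set α) = (q : ℕ∞)) (hrG : M.eRk ((insert a (insert a' τ) : Finset α) : Set α) = (q : ℕ∞) + 1)
    (hq : 1 ≤ q) (ht : t ≤ q + 1) (hP : 0 ≤ hypAddTwoProfile M τ a a' q t) :
    0 ≤ Jq M (insert a (insert a' τ)) (q + 1) t :=
  hP.trans (Jq_hyp_add_two_ge_profile ha ha' hne haτ ha'τ hacl ha'cl hrτ hrG hq ht)

end HypAddTwoAll

end PercRepro.GenQ
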